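import Summits.AtomisticToContinuum.FouriersLaw.Theorems.JunctionLocalityNonBallisticStubLightConeWindow
import Summits.AtomisticToContinuum.FouriersLaw.Theorems.EmbeddedDrudeMourreAbelThermodynamicLimitCentralBondCurrentSecondMoments

/-!
# Leaf (C) `stub_anchoredCorrelationTails`, part 3: one-site tails under the stationary law, uniformly in `N`
(crux `EmbeddedDrudeMourre.AbelThermodynamicLimit`, item stmt-AtomisticToContinuum-12596, line
`loomis-compact-horizon-witness`; `--supports` file proving the registered sub-goal `stub_coneMomentumTailEight`)

The two one-site tails that control the distance-growing boxes of part 2, both uniform in `N` AND in the site: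
* `pinnedChain_probSite_timeIntegral_momentum_sq_gt_eight` — `(μ_T ⊗ W){a < ∫₀ᵗ p_i(Φ_r)²} ≤ 15!! T⁸ t⁸ / a⁸`
  (Markov with the EIGHTH power: Cauchy–Schwarz in time thrice, Tonelli, stationarity of the kernel process started
  from the Gibbs measure on the Wiener space, Gaussian sixteenth moment; the tree's fourth-power version
  `pinnedChain_probSite_timeIntegral_momentum_sq_gt` is not summable enough);
* `pinnedChain_gibbsMeasure_sq_position_gt_le` — `μ_{N,T}{b < q_k²} ≤ κ₁₆ / b⁸` with the ONE-SITE ratio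
  `κ₁₆ = ∫ a¹⁶ e^{-U/T} / ∫ e^{-U/T}` (one-site domination at every site,
  `ChainVariation.pinnedChain_lintegral_coord_gibbsWeight_le`).
-/

noncomputable section

namespace Summit.AtomisticToContinuum.FouriersLaw.Theorems.AbelThermodynamicLimit.LoomisCompactHorizonWitness

open MeasureTheory ProbabilityTheory Set Filter Topology
open scoped NNReal ENNReal
open Literature.MathematicalPhysics.KineticTheory Literature.MathematicalPhysics.KineticTheory.HeatConduction
open Literature.Probability.Process OscillatorChain
open Summit.AtomisticToContinuum.FouriersLaw.Theorems.NonBallistic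
open Summit.AtomisticToContinuum.FouriersLaw.Theorems.NonBallistic.LightConePropagation
open Summit.AtomisticToContinuum.FouriersLaw.Theorems.PhononMeanFreePath (commonPastBound_gibbsEvenMoments)
open Summit.AtomisticToContinuum.FouriersLaw.Theorems.SubdiffusiveBondHeat
open Summit.AtomisticToContinuum.FouriersLaw.Theorems.ChainVariation

/-! ### §2 Failure probability of the growing boxes: the momentum tail with the sixteenth Gaussian moment -/

section MomentumTail

variable {ω₂ lam β γ : ℝ} (hω : 0 < ω₂) (hl : 0 ≤ lam) (hβ : 0 ≤ β) (hγ : 0 ≤ γ) (N : ℕ) {T : ℝ}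

include hω hl hβ hγ in
/-- **Tonelli + stationarity + the Gaussian sixteenth moment**:
`∫ (∫_{(0,t]} p_i(Φ_r(x,Bω))¹⁶ dr) d(μ_T ⊗ W) = 2027025 T⁸ · t⁺` (`2027025 = 15!!`). [folklore] -/
theorem pinnedChain_lintegral_timeIntegral_momentum_pow_sixteen (hN : 0 < N) (hT : 0 < T) (t : ℝ) (i : Fin N) :
    ∫⁻ q, (∫⁻ r in Ioc 0 t, ENNReal.ofReal (((pinnedChain ω₂ lam β γ).solMap N T T r q.1 (pairPath q.2)).2 i ^ 16))
        ∂(((pinnedChain ω₂ lam β γ).gibbsMeasure N T).prod wienerPair) =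
      ENNReal.ofReal (2027025 * T ^ 8) * ENNReal.ofReal t := by
  -- adapted from `pinnedChain_lintegral_timeIntegral_momentum_pow_eight` (…NonBallisticLightConeMomentumTail)
  haveI : IsProbabilityMeasure ((pinnedChain ω₂ lam β γ).gibbsMeasure N T) :=
    pinnedChain_isProbabilityMeasure_gibbsMeasure hω hl hβ γ N hT
  have hf : Measurable fun qr : (PhaseSpace N × WienerPair) × ℝ =>
      ENNReal.ofReal (((pinnedChain ω₂ lam β γ).solMap N T T qr.2 qr.1.1 (pairPath qr.1.2)).2 i ^ 16) := by
    have h1 := pinnedChain_measurable_solMap_pairPath_uncurry_swap hω hl hβ hγ N T T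
    exact (((measurable_pi_apply i).comp (measurable_snd.comp h1)).pow_const 16).ennreal_ofReal
  have hswap : ∫⁻ q, (∫⁻ r in Ioc 0 t,
        ENNReal.ofReal (((pinnedChain ω₂ lam β γ).solMap N T T r q.1 (pairPath q.2)).2 i ^ 16))
        ∂(((pinnedChain ω₂ lam β γ).gibbsMeasure N T).prod wienerPair) =
      ∫⁻ r in Ioc 0 t, (∫⁻ q,
        ENNReal.ofReal (((pinnedChain ω₂ lam β γ).solMap N T T r q.1 (pairPath q.2)).2 i ^ 16)
        ∂(((pinnedChain ω₂ lam β γ).gibbsMeasure N T).prod wienerPair)) := by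
    have hf' : AEMeasurable (Function.uncurry fun (q : PhaseSpace N × WienerPair) (r : ℝ) =>
        ENNReal.ofReal (((pinnedChain ω₂ lam β γ).solMap N T T r q.1 (pairPath q.2)).2 i ^ 16))
        ((((pinnedChain ω₂ lam β γ).gibbsMeasure N T).prod wienerPair).prod (volume.restrict (Ioc 0 t))) :=
      hf.aemeasurable
    exact lintegral_lintegral_swap hf'
  rw [hswap]
  have hstat : ∀ r : ℝ, (∫⁻ q,
      ENNReal.ofReal (((pinnedChain ω₂ lam β γ).solMap N T T r q.1 (pairPath q.2)).2 i ^ 16)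
        ∂(((pinnedChain ω₂ lam β γ).gibbsMeasure N T).prod wienerPair)) = ENNReal.ofReal (2027025 * T ^ 8) := by
    intro r
    rw [pinnedChain_lintegral_prod_solMap_gibbs hω hl hβ hγ N hN hT r
      (g := fun y : PhaseSpace N => ENNReal.ofReal (y.2 i ^ 16)) (by fun_prop)]
    obtain ⟨hint, hval⟩ := commonPastBound_gibbsEvenMoments ω₂ lam β γ hω hl hβ T hT N i 8
    simp only [Finset.prod_range_succ, Finset.prod_range_zero] at hint hval
    norm_num at hint hval
    rw [← ofReal_integral_eq_lintegral_ofReal hint (ae_of_all _ fun y => by positivity), hval]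
    congr 1
    ring
  rw [lintegral_congr hstat, setLIntegral_const, Real.volume_Ioc, sub_zero]

include hω hl hβ hγ in
/-- **One-site tail bound with the eighth power.** For `t ≥ 0`, `a > 0` and every site `i`,
`(μ_T ⊗ W) {a < ∫₀ᵗ p_i(Φ_r(x,Bω))² dr} ≤ ENNReal.ofReal (2027025 T⁸ t⁸ / a⁸)` (Markov with the eighth power,
Cauchy–Schwarz in time three times, Tonelli, stationarity, `∫ p_i¹⁶ dμ_T = 15!! T⁸`). [folklore] -/
theorem pinnedChain_probSite_timeIntegral_momentum_sq_gt_eight (hN : 0 < N) (hT : 0 < T) {t a : ℝ} (ht : 0 ≤ t)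
    (ha : 0 < a) (i : Fin N) :
    (((pinnedChain ω₂ lam β γ).gibbsMeasure N T).prod wienerPair)
        {q | a < ∫ r in (0:ℝ)..t, ((pinnedChain ω₂ lam β γ).solMap N T T r q.1 (pairPath q.2)).2 i ^ 2} ≤
      ENNReal.ofReal (2027025 * T ^ 8 * t ^ 8 / a ^ 8) := by
  -- adapted from `pinnedChain_probSite_timeIntegral_momentum_sq_gt` (…NonBallisticLightConeMomentumTail)
  haveI : IsProbabilityMeasure ((pinnedChain ω₂ lam β γ).gibbsMeasure N T) :=
    pinnedChain_isProbabilityMeasure_gibbsMeasure hω hl hβ γ N hT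
  set π := ((pinnedChain ω₂ lam β γ).gibbsMeasure N T).prod wienerPair with hπ
  set p : ℝ → PhaseSpace N × WienerPair → ℝ := fun r q =>
    ((pinnedChain ω₂ lam β γ).solMap N T T r q.1 (pairPath q.2)).2 i with hp
  have hpc : ∀ q, Continuous fun r => p r q := fun q =>
    (continuous_apply i).comp (continuous_snd.comp
      (pinnedChain_continuous_solMap hω hl hβ hγ N T T q.1 (pairPath q.2)))
  have hpm : ∀ k : ℕ, Measurable fun qr : (PhaseSpace N × WienerPair) × ℝ => ENNReal.ofReal (p qr.2 qr.1 ^ k) := by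
    intro k
    have h1 := pinnedChain_measurable_solMap_pairPath_uncurry_swap hω hl hβ hγ N T T
    exact (((measurable_pi_apply i).comp (measurable_snd.comp h1)).pow_const k).ennreal_ofReal
  set Xl : PhaseSpace N × WienerPair → ℝ≥0∞ := fun q => ∫⁻ r in Ioc 0 t, ENNReal.ofReal (p r q ^ 2) with hXl
  set Yl : PhaseSpace N × WienerPair → ℝ≥0∞ := fun q => ∫⁻ r in Ioc 0 t, ENNReal.ofReal (p r q ^ 16) with hYl
  have hXlm : Measurable Xl := (hpm 2).lintegral_prod_right'
  have hofReal : ∀ {k : ℕ}, Even k → ∀ q : PhaseSpace N × WienerPair,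
      ENNReal.ofReal (∫ r in (0:ℝ)..t, p r q ^ k) = ∫⁻ r in Ioc 0 t, ENNReal.ofReal (p r q ^ k) := by
    intro k hk q
    rw [intervalIntegral.integral_of_le ht]
    exact ofReal_integral_eq_lintegral_ofReal ((hpc q).pow k).integrableOn_Ioc
      (ae_of_all _ fun r => hk.pow_nonneg _)
  -- pointwise: `X⁸ ≤ t⁷ Y` (Cauchy–Schwarz in time, three times)
  have hJ : ∀ q, Xl q ^ 8 ≤ ENNReal.ofReal (t ^ 7) * Yl q := by
    intro q
    have hX0 : 0 ≤ ∫ r in (0:ℝ)..t, p r q ^ 2 := intervalIntegral.integral_nonneg ht fun r _ => sq_nonneg _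
    have hI4 : 0 ≤ ∫ r in (0:ℝ)..t, p r q ^ 4 :=
      intervalIntegral.integral_nonneg ht fun r _ => by positivity
    have hI8 : 0 ≤ ∫ r in (0:ℝ)..t, p r q ^ 8 :=
      intervalIntegral.integral_nonneg ht fun r _ => by positivity
    have h1 := sq_intervalIntegral_pow_le_mul_intervalIntegral_pow (hpc q) ht 2
    have h2 := sq_intervalIntegral_pow_le_mul_intervalIntegral_pow (hpc q) ht 4
    have h3 := sq_intervalIntegral_pow_le_mul_intervalIntegral_pow (hpc q) ht 8
    norm_num at h1 h2 h3
    have s1 : ((∫ r in (0:ℝ)..t, p r q ^ 2) ^ 2) ^ 2 ≤ t ^ 3 * ∫ r in (0:ℝ)..t, p r q ^ 8 :=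
      calc ((∫ r in (0:ℝ)..t, p r q ^ 2) ^ 2) ^ 2 ≤ (t * ∫ r in (0:ℝ)..t, p r q ^ 4) ^ 2 :=
            pow_le_pow_left₀ (sq_nonneg _) h1 2
        _ = t ^ 2 * (∫ r in (0:ℝ)..t, p r q ^ 4) ^ 2 := by ring
        _ ≤ t ^ 2 * (t * ∫ r in (0:ℝ)..t, p r q ^ 8) := mul_le_mul_of_nonneg_left h2 (sq_nonneg _)
        _ = t ^ 3 * ∫ r in (0:ℝ)..t, p r q ^ 8 := by ring
    have hreal : (∫ r in (0:ℝ)..t, p r q ^ 2) ^ 8 ≤ t ^ 7 * ∫ r in (0:ℝ)..t, p r q ^ 16 :=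
      calc (∫ r in (0:ℝ)..t, p r q ^ 2) ^ 8 = (((∫ r in (0:ℝ)..t, p r q ^ 2) ^ 2) ^ 2) ^ 2 := by ring
        _ ≤ (t ^ 3 * ∫ r in (0:ℝ)..t, p r q ^ 8) ^ 2 := pow_le_pow_left₀ (by positivity) s1 2
        _ = t ^ 6 * (∫ r in (0:ℝ)..t, p r q ^ 8) ^ 2 := by ring
        _ ≤ t ^ 6 * (t * ∫ r in (0:ℝ)..t, p r q ^ 16) := mul_le_mul_of_nonneg_left h3 (by positivity)
        _ = t ^ 7 * ∫ r in (0:ℝ)..t, p r q ^ 16 := by ring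
    calc Xl q ^ 8 = ENNReal.ofReal ((∫ r in (0:ℝ)..t, p r q ^ 2) ^ 8) := by
          rw [ENNReal.ofReal_pow hX0, hofReal even_two q]
      _ ≤ ENNReal.ofReal (t ^ 7 * ∫ r in (0:ℝ)..t, p r q ^ 16) := ENNReal.ofReal_le_ofReal hreal
      _ = ENNReal.ofReal (t ^ 7) * Yl q := by
          rw [ENNReal.ofReal_mul (pow_nonneg ht 7), hofReal (by decide) q]
  have hsub : {q : PhaseSpace N × WienerPair | a < ∫ r in (0:ℝ)..t, p r q ^ 2} ⊆
      {q | ENNReal.ofReal a ^ 8 ≤ Xl q ^ 8} := by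
    intro q hq
    simp only [Set.mem_setOf_eq] at hq ⊢
    have h : ENNReal.ofReal a ≤ Xl q := by
      show ENNReal.ofReal a ≤ ∫⁻ r in Ioc 0 t, ENNReal.ofReal (p r q ^ 2)
      rw [← hofReal even_two q]
      exact ENNReal.ofReal_le_ofReal hq.le
    gcongr
  have ha8 : ENNReal.ofReal a ^ 8 ≠ 0 := pow_ne_zero _ (ENNReal.ofReal_pos.2 ha).ne'
  have ha8' : ENNReal.ofReal a ^ 8 ≠ ∞ := ENNReal.pow_ne_top ENNReal.ofReal_ne_top
  have hYI : ∫⁻ q, Yl q ∂π = ENNReal.ofReal (2027025 * T ^ 8) * ENNReal.ofReal t :=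
    pinnedChain_lintegral_timeIntegral_momentum_pow_sixteen hω hl hβ hγ N hN hT t i
  calc π {q | a < ∫ r in (0:ℝ)..t, p r q ^ 2}
      ≤ π {q | ENNReal.ofReal a ^ 8 ≤ Xl q ^ 8} := measure_mono hsub
    _ ≤ (∫⁻ q, Xl q ^ 8 ∂π) / ENNReal.ofReal a ^ 8 :=
        meas_ge_le_lintegral_div (hXlm.pow_const 8).aemeasurable ha8 ha8'
    _ ≤ (∫⁻ q, ENNReal.ofReal (t ^ 7) * Yl q ∂π) / ENNReal.ofReal a ^ 8 :=
        ENNReal.div_le_div_right (lintegral_mono fun q => hJ q) _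
    _ = ENNReal.ofReal (t ^ 7) * (ENNReal.ofReal (2027025 * T ^ 8) * ENNReal.ofReal t) / ENNReal.ofReal a ^ 8 := by
        rw [lintegral_const_mul' _ _ ENNReal.ofReal_ne_top, hYI]
    _ = ENNReal.ofReal (2027025 * T ^ 8 * t ^ 8 / a ^ 8) := by
        rw [show 2027025 * T ^ 8 * t ^ 8 / a ^ 8 = t ^ 7 * (2027025 * T ^ 8 * t) / a ^ 8 by ring,
          ENNReal.ofReal_div_of_pos (pow_pos ha 8), ENNReal.ofReal_mul (pow_nonneg ht 7),
          ENNReal.ofReal_mul (by positivity : (0:ℝ) ≤ 2027025 * T ^ 8), ENNReal.ofReal_pow ha.le]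

end MomentumTail

/-! ### §2.2 The one-site position tail of the Gibbs measure -/

section PositionTail

variable {ω₂ lam β γ : ℝ} (hω : 0 < ω₂) (hl : 0 ≤ lam) (hβ : 0 ≤ β) {T : ℝ} (hT : 0 < T)
include hω hl hβ hT

/-- **`N`-uniform sixteenth moment of a position under the Gibbs measure**, Lebesgue form:
`∫⁻ q_k¹⁶ dμ_{N,T} ≤ κ₁₆ = ∫ a¹⁶ e^{-U(a)/T} da / ∫ e^{-U(a)/T} da` (one-site domination at every site,
`ChainVariation.pinnedChain_lintegral_coord_gibbsWeight_le`); `κ₁₆ < ∞`. [folklore] -/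
theorem pinnedChain_lintegral_position_pow_sixteen_le {N : ℕ} (k : Fin N) :
    ∫⁻ x, ENNReal.ofReal (x.1 k ^ 16) ∂((pinnedChain ω₂ lam β γ).gibbsMeasure N T) ≤
      (∫⁻ a, ENNReal.ofReal (a ^ 16) * ENNReal.ofReal (Real.exp (-(pinnedChain ω₂ lam β γ).U a / T))) /
        ∫⁻ a, ENNReal.ofReal (Real.exp (-(pinnedChain ω₂ lam β γ).U a / T)) ∧
    (∫⁻ a, ENNReal.ofReal (a ^ 16) * ENNReal.ofReal (Real.exp (-(pinnedChain ω₂ lam β γ).U a / T))) /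
        ∫⁻ a, ENNReal.ofReal (Real.exp (-(pinnedChain ω₂ lam β γ).U a / T)) ≠ ⊤ := by
  set P := pinnedChain ω₂ lam β γ with hP
  set K := ∫⁻ a, ENNReal.ofReal (a ^ 16) * ENNReal.ofReal (Real.exp (-P.U a / T)) with hK
  set ZU := ∫⁻ a, ENNReal.ofReal (Real.exp (-P.U a / T)) with hZU
  have hKfin : K ≠ ⊤ := by
    have := pinnedChain_lintegral_pow_mul_exp_neg_U_ne_top (β := β) hω hl γ hT 8
    simpa using this
  have hZU0 : ZU ≠ 0 := pinnedChain_lintegral_exp_neg_U_ne_zero ω₂ lam β γ T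
  have hZUfin : ZU ≠ ⊤ := pinnedChain_lintegral_exp_neg_U_ne_top (β := β) hω hl γ hT
  refine ⟨?_, ENNReal.div_ne_top hKfin hZU0⟩
  have hZint := pinnedChain_integrable_gibbsDensity hω hl hβ γ N hT
  set Z := P.partitionFunction N T with hZ
  have hZpos : 0 < ∫ x, P.gibbsDensity N T x := integral_exp_pos hZint
  have hZ0 : Z ≠ 0 := by
    rw [hZ, P.partitionFunction_eq_ofReal_integral hZint]
    exact (ENNReal.ofReal_pos.2 hZpos).ne'
  have hZtop : Z ≠ ⊤ := by
    rw [hZ, P.partitionFunction_eq_ofReal_integral hZint]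
    exact ENNReal.ofReal_ne_top
  have hρm : Measurable fun x : PhaseSpace N => ENNReal.ofReal (P.gibbsDensity N T x) :=
    (pinnedChain_continuous_gibbsDensity ω₂ lam β γ N T).measurable.ennreal_ofReal
  have hfm : Measurable fun x : PhaseSpace N => ENNReal.ofReal (x.1 k ^ 16) :=
    (((measurable_pi_apply k).comp measurable_fst).pow_const 16).ennreal_ofReal
  -- one-site domination
  have hdom := pinnedChain_lintegral_coord_gibbsWeight_le hω hl hβ γ hT k
    (h := fun a : ℝ => ENNReal.ofReal (a ^ 16)) (by fun_prop)
    (fun a b hab => ENNReal.ofReal_le_ofReal (by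
      have : |a| ^ 16 ≤ |b| ^ 16 := pow_le_pow_left₀ (abs_nonneg a) hab 16
      have ea : |a| ^ 16 = a ^ 16 := by rw [show (16:ℕ) = 2 * 8 by rfl, pow_mul, sq_abs, ← pow_mul]
      have eb : |b| ^ 16 = b ^ 16 := by rw [show (16:ℕ) = 2 * 8 by rfl, pow_mul, sq_abs, ← pow_mul]
      rwa [ea, eb] at this))
  have hZ' : ∫⁻ x : PhaseSpace N, ENNReal.ofReal (Real.exp (-P.hamiltonian N x / T)) = Z := rfl
  rw [hZ'] at hdom
  change (∫⁻ x : PhaseSpace N, ENNReal.ofReal (x.1 k ^ 16) * ENNReal.ofReal (P.gibbsDensity N T x)) * ZU ≤ K * Z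
    at hdom
  have hle : ∫⁻ x : PhaseSpace N, ENNReal.ofReal (x.1 k ^ 16) * ENNReal.ofReal (P.gibbsDensity N T x) ≤
      K * Z / ZU := by
    rw [ENNReal.le_div_iff_mul_le (Or.inl hZU0) (Or.inl hZUfin)]
    exact hdom
  -- the Gibbs integral
  rw [P.gibbsMeasure_eq_smul_withDensity hZint, lintegral_smul_measure,
    lintegral_withDensity_eq_lintegral_mul _ hρm hfm]
  simp only [Pi.mul_apply]
  have hcomm : ∫⁻ x : PhaseSpace N, ENNReal.ofReal (P.gibbsDensity N T x) * ENNReal.ofReal (x.1 k ^ 16) =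
      ∫⁻ x : PhaseSpace N, ENNReal.ofReal (x.1 k ^ 16) * ENNReal.ofReal (P.gibbsDensity N T x) :=
    lintegral_congr fun x => mul_comm _ _
  rw [hcomm, ← hZ, smul_eq_mul]
  calc Z⁻¹ * ∫⁻ x : PhaseSpace N, ENNReal.ofReal (x.1 k ^ 16) * ENNReal.ofReal (P.gibbsDensity N T x)
      ≤ Z⁻¹ * (K * Z / ZU) := mul_le_mul' le_rfl hle
    _ = (Z⁻¹ * Z) * (K / ZU) := by rw [div_eq_mul_inv, div_eq_mul_inv]; ring
    _ = K / ZU := by rw [ENNReal.inv_mul_cancel hZ0 hZtop, one_mul]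

/-- **One-site position tail of the Gibbs measure**, uniformly in `N` and the site: for `b > 0`,
`μ_{N,T} {b < q_k²} ≤ κ₁₆ / b⁸` (Markov with the sixteenth moment). [folklore] -/
theorem pinnedChain_gibbsMeasure_sq_position_gt_le {N : ℕ} (k : Fin N) {b : ℝ} (hb : 0 < b) :
    (pinnedChain ω₂ lam β γ).gibbsMeasure N T {x | b < x.1 k ^ 2} ≤
      (∫⁻ a, ENNReal.ofReal (a ^ 16) * ENNReal.ofReal (Real.exp (-(pinnedChain ω₂ lam β γ).U a / T))) /
          (∫⁻ a, ENNReal.ofReal (Real.exp (-(pinnedChain ω₂ lam β γ).U a / T))) /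
        ENNReal.ofReal (b ^ 8) := by
  set μ := (pinnedChain ω₂ lam β γ).gibbsMeasure N T with hμ
  have hfm : Measurable fun x : PhaseSpace N => ENNReal.ofReal (x.1 k ^ 16) :=
    (((measurable_pi_apply k).comp measurable_fst).pow_const 16).ennreal_ofReal
  have hsub : {x : PhaseSpace N | b < x.1 k ^ 2} ⊆ {x | ENNReal.ofReal (b ^ 8) ≤ ENNReal.ofReal (x.1 k ^ 16)} := by
    intro x hx
    simp only [Set.mem_setOf_eq] at hx ⊢
    refine ENNReal.ofReal_le_ofReal ?_
    calc b ^ 8 ≤ (x.1 k ^ 2) ^ 8 := pow_le_pow_left₀ hb.le hx.le 8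
      _ = x.1 k ^ 16 := by ring
  have hb8 : ENNReal.ofReal (b ^ 8) ≠ 0 := (ENNReal.ofReal_pos.2 (pow_pos hb 8)).ne'
  calc μ {x | b < x.1 k ^ 2} ≤ μ {x | ENNReal.ofReal (b ^ 8) ≤ ENNReal.ofReal (x.1 k ^ 16)} := measure_mono hsub
    _ ≤ (∫⁻ x, ENNReal.ofReal (x.1 k ^ 16) ∂μ) / ENNReal.ofReal (b ^ 8) :=
        meas_ge_le_lintegral_div hfm.aemeasurable hb8 ENNReal.ofReal_ne_top
    _ ≤ _ := ENNReal.div_le_div_right (pinnedChain_lintegral_position_pow_sixteen_le hω hl hβ hT k).1 _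

end PositionTail


/-- **Registered sub-goal `stub_coneMomentumTailEight`** (leaf (C) of S4, line `loomis-compact-horizon-witness`):
the one-site tail of the time-integrated squared momentum along the stationary kernel process with the eighth power,
uniformly in `N` and the site (`pinnedChain_probSite_timeIntegral_momentum_sq_gt_eight`, closed form). [folklore] -/
theorem stub_coneMomentumTailEight :
    ∀ ω₂ lam β γ : ℝ, 0 < ω₂ → 0 ≤ lam → 0 ≤ β → 0 ≤ γ → ∀ (N : ℕ), 0 < N → ∀ T : ℝ, 0 < T →
      ∀ (t a : ℝ), 0 ≤ t → 0 < a → ∀ i : Fin N,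
        (((Literature.MathematicalPhysics.KineticTheory.HeatConduction.pinnedChain ω₂ lam β γ).gibbsMeasure N T).prod
            Literature.Probability.Process.wienerPair)
          {q | a < ∫ r in (0:ℝ)..t, ((Literature.MathematicalPhysics.KineticTheory.HeatConduction.pinnedChain ω₂ lam β γ).solMap
            N T T r q.1 (Literature.Probability.Process.pairPath q.2)).2 i ^ 2} ≤
          ENNReal.ofReal (2027025 * T ^ 8 * t ^ 8 / a ^ 8) :=
  fun _ _ _ _ hω hl hβ hγ N hN _ hT _ _ ht ha i =>
    pinnedChain_probSite_timeIntegral_momentum_sq_gt_eight hω hl hβ hγ N hN hT ht ha i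

end Summit.AtomisticToContinuum.FouriersLaw.Theorems.AbelThermodynamicLimit.LoomisCompactHorizonWitness

end
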